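import Summits.CriticalPhenomena.CardyFormulaZ2.Theorems.CardyFlipRussoCoveringLegRobustDefs
import HarnessLib

/-!
# Stub `stub_gsPlanar` of line `five-arm-null` (skeleton v5) of the crux `CardyFlipRusso.CoveringLeg`
(stmt-CriticalPhenomena-6435)

Helper file `--supports stmt-CriticalPhenomena-6435`, proving EXACTLY the registered statement
`Sig.stub_gsPlanar` of `CardyFlipRussoCoveringLegRobustDefs.lean`: **the straight-line drawing `zS` of
Beffara's centred square lattice `G_s` is planar** — `zS` is injective, no vertex lies on a non-incident
closed edge segment, and vertex-disjoint edges have disjoint closed segments.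

Proof (pure lattice arithmetic).  In the integer coordinates `P = √2·zS` (`planar_zS_inl_re`, …) the
type-I site `Sum.inl (x₁, x₂)` sits at `(x₁ + x₂, x₂ − x₁ + 1)` (an ODD point of `ℤ²`) and the face centre
`Sum.inr (f₁, f₂)` at `(f₁ + f₂ + 1, f₂ − f₁ + 1)` (an EVEN point); `P` is injective
(`planar_zS_eq_of_coord`).  Every edge of `G_s`, suitably oriented, is a step `p ↦ p + d` with
`d ∈ {(1,0), (0,1)}` (site–centre edges) or `d ∈ {(1,1), (1,−1)}` from an odd point `p` (site–site edges)
(`planar_gs_edge`).  A point of the closed segment `[p, p + d]` is `p + θ d`, `θ ∈ [0,1]`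
(`planar_seg_param`); comparing the two coordinates of a common point of two such segments (or of a
lattice point on one segment) forces an INTEGER combination of the parameters to lie in `[0,1]` or
`[-1,1]` (`planar_unitI_int`, `planar_unitI_int_sub`), and the sixteen step-class combinations are then
finished by `omega` (`planar_step_cross`, `planar_step_vertex`); the only place where parity enters is a
diagonal meeting an anti-diagonal (two diagonals of one unit cell never both occur: only odd–odd
diagonals are edges).

Source: V. Beffara, *Is critical 2D percolation universal?*, Progr. Probab. 60 (2008) §5.1 (the lattice
`G_s`, a triangulation) [Beffara2008Universal]; the planarity argument itself is folklore.
-/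

noncomputable section

namespace Summit.CriticalPhenomena.CardyFormulaZ2.Cruxes.CoveringLeg.FiveArmNull

open Set
open Literature.Probability.Percolation
open Literature.Barriers.CriticalPhenomena (MixedSite)

/-! ### Integer coordinates `√2 · zS` -/

/-- First integer coordinate of a type-I site: `√2 · Re zS (inl x) = x₁ + x₂`.
[cite: Beffara2008Universal, §5.1] -/
theorem planar_zS_inl_re (x1 x2 : ℤ) :
    Real.sqrt 2 * (zS (Sum.inl (x1, x2))).re = ((x1 + x2 : ℤ) : ℝ) := by
  have h : Real.sqrt 2 ≠ 0 := by positivity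
  have e : zS (Sum.inl (x1, x2)) =
      (((x1 + x2 : ℤ) : ℂ) + ((x2 - x1 + 1 : ℤ) : ℂ) * Complex.I) / (Real.sqrt 2 : ℂ) := rfl
  rw [e, Complex.div_ofReal_re, mul_div_cancel₀ _ h]
  simp

/-- Second integer coordinate of a type-I site: `√2 · Im zS (inl x) = x₂ - x₁ + 1`.
[cite: Beffara2008Universal, §5.1] -/
theorem planar_zS_inl_im (x1 x2 : ℤ) :
    Real.sqrt 2 * (zS (Sum.inl (x1, x2))).im = ((x2 - x1 + 1 : ℤ) : ℝ) := by
  have h : Real.sqrt 2 ≠ 0 := by positivity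
  have e : zS (Sum.inl (x1, x2)) =
      (((x1 + x2 : ℤ) : ℂ) + ((x2 - x1 + 1 : ℤ) : ℂ) * Complex.I) / (Real.sqrt 2 : ℂ) := rfl
  rw [e, Complex.div_ofReal_im, mul_div_cancel₀ _ h]
  simp

/-- First integer coordinate of a face centre: `√2 · Re zS (inr f) = f₁ + f₂ + 1`.
[cite: Beffara2008Universal, §5.1] -/
theorem planar_zS_inr_re (f1 f2 : ℤ) :
    Real.sqrt 2 * (zS (Sum.inr (f1, f2))).re = ((f1 + f2 + 1 : ℤ) : ℝ) := by
  have h : Real.sqrt 2 ≠ 0 := by positivity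
  have e : zS (Sum.inr (f1, f2)) =
      (((f1 + f2 + 1 : ℤ) : ℂ) + ((f2 - f1 + 1 : ℤ) : ℂ) * Complex.I) / (Real.sqrt 2 : ℂ) := rfl
  rw [e, Complex.div_ofReal_re, mul_div_cancel₀ _ h]
  simp

/-- Second integer coordinate of a face centre: `√2 · Im zS (inr f) = f₂ - f₁ + 1`.
[cite: Beffara2008Universal, §5.1] -/
theorem planar_zS_inr_im (f1 f2 : ℤ) :
    Real.sqrt 2 * (zS (Sum.inr (f1, f2))).im = ((f2 - f1 + 1 : ℤ) : ℝ) := by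
  have h : Real.sqrt 2 ≠ 0 := by positivity
  have e : zS (Sum.inr (f1, f2)) =
      (((f1 + f2 + 1 : ℤ) : ℂ) + ((f2 - f1 + 1 : ℤ) : ℂ) * Complex.I) / (Real.sqrt 2 : ℂ) := rfl
  rw [e, Complex.div_ofReal_im, mul_div_cancel₀ _ h]
  simp

/-- **`√2 · zS` is injective**: two vertices with the same integer coordinates are equal (solve the
`2 × 2` systems; the parity of the coordinate sum separates sites from centres). [folklore] -/
theorem planar_zS_eq_of_coord {w w' : MixedSite}
    (hre : Real.sqrt 2 * (zS w).re = Real.sqrt 2 * (zS w').re)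
    (him : Real.sqrt 2 * (zS w).im = Real.sqrt 2 * (zS w').im) : w = w' := by
  rcases w with ⟨x1, x2⟩ | ⟨f1, f2⟩ <;> rcases w' with ⟨y1, y2⟩ | ⟨g1, g2⟩ <;>
    simp only [planar_zS_inl_re, planar_zS_inl_im, planar_zS_inr_re, planar_zS_inr_im,
      Int.cast_inj] at hre him <;>
    simp only [Sum.inl.injEq, Sum.inr.injEq, Prod.mk.injEq, reduceCtorEq] <;> omega

/-- **The drawing `zS` is injective.** [cite: Beffara2008Universal, §5.1] -/
theorem planar_zS_injective : Function.Injective zS := fun _ _ h =>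
  planar_zS_eq_of_coord (by rw [h]) (by rw [h])

/-! ### Segments and the unit-interval integrality trick -/

/-- A point of the closed segment `[p, q]` is `p + θ (q - p)` with `θ ∈ [0, 1]`, read in (scaled) real
coordinates. [folklore] -/
theorem planar_seg_param {p q z : ℂ} (r : ℝ) (hz : z ∈ segment ℝ p q) :
    ∃ θ : ℝ, 0 ≤ θ ∧ θ ≤ 1 ∧ r * z.re = r * p.re + θ * (r * q.re - r * p.re) ∧
      r * z.im = r * p.im + θ * (r * q.im - r * p.im) := by
  obtain ⟨θ₁, θ₂, h₁, h₂, hsum, rfl⟩ := hz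
  refine ⟨θ₂, h₂, by linarith, ?_, ?_⟩
  · simp only [Complex.add_re, Complex.smul_re, smul_eq_mul]
    rw [show θ₁ = 1 - θ₂ by linarith]
    ring
  · simp only [Complex.add_im, Complex.smul_im, smul_eq_mul]
    rw [show θ₁ = 1 - θ₂ by linarith]
    ring

/-- An integer which, read in `ℝ`, lies in `[0, 1]` is `0` or `1`. [folklore] -/
theorem planar_unitI_int {k : ℤ} {t : ℝ} (h : (k : ℝ) = t) (h0 : 0 ≤ t) (h1 : t ≤ 1) :
    0 ≤ k ∧ k ≤ 1 := by
  rw [← h] at h0 h1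
  exact ⟨by exact_mod_cast h0, by exact_mod_cast h1⟩

/-- An integer which is the difference of two reals of `[0, 1]` lies in `[-1, 1]`. [folklore] -/
theorem planar_unitI_int_sub {k : ℤ} {t s : ℝ} (h : (k : ℝ) = t - s) (ht0 : 0 ≤ t) (ht1 : t ≤ 1)
    (hs0 : 0 ≤ s) (hs1 : s ≤ 1) : -1 ≤ k ∧ k ≤ 1 := by
  have h0 : (-1 : ℝ) ≤ k := by rw [h]; linarith
  have h1 : (k : ℝ) ≤ 1 := by rw [h]; linarith
  exact ⟨by exact_mod_cast h0, by exact_mod_cast h1⟩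

/-! ### The two core case analyses on step classes -/

/-- **A lattice point on a step segment is an endpoint.**  If `(m, n) = (a, b) + θ d` with `θ ∈ [0,1]`
and `d` one of the four step classes, then `(m, n)` is `(a, b)` or `(a, b) + d`. [folklore] -/
theorem planar_step_vertex {a b d1 d2 m n : ℤ} {θ : ℝ}
    (hd : (d1 = 1 ∧ d2 = 0) ∨ (d1 = 0 ∧ d2 = 1) ∨ (d1 = 1 ∧ d2 = 1 ∧ ∃ k : ℤ, a + b = 2 * k + 1) ∨
      (d1 = 1 ∧ d2 = -1 ∧ ∃ k : ℤ, a + b = 2 * k + 1))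
    (hθ0 : 0 ≤ θ) (hθ1 : θ ≤ 1)
    (hX : (a : ℝ) + θ * d1 = m) (hY : (b : ℝ) + θ * d2 = n) :
    (m = a ∧ n = b) ∨ (m = a + d1 ∧ n = b + d2) := by
  rcases hd with ⟨rfl, rfl⟩ | ⟨rfl, rfl⟩ | ⟨rfl, rfl, -⟩ | ⟨rfl, rfl, -⟩ <;> push_cast at hX hY
  · have f := planar_unitI_int (k := m - a) (by push_cast; linarith) hθ0 hθ1
    have g : b = n := by exact_mod_cast (show (b : ℝ) = n by linarith)
    omega
  · have f := planar_unitI_int (k := n - b) (by push_cast; linarith) hθ0 hθ1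
    have g : a = m := by exact_mod_cast (show (a : ℝ) = m by linarith)
    omega
  · have f := planar_unitI_int (k := m - a) (by push_cast; linarith) hθ0 hθ1
    have g : m - a = n - b := by exact_mod_cast (show (m : ℝ) - a = n - b by linarith)
    omega
  · have f := planar_unitI_int (k := m - a) (by push_cast; linarith) hθ0 hθ1
    have g : m - a = b - n := by exact_mod_cast (show (m : ℝ) - a = b - n by linarith)
    omega

/-- **Two step segments with four distinct endpoints are disjoint** (contrapositive, in coordinates):
if `(a, b) + θ d = (a', b') + s e` with `θ, s ∈ [0, 1]` and `d, e` step classes (diagonal classes only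
from odd points), then the two steps share an endpoint.  Sixteen cases; parity is used only for a
diagonal against an anti-diagonal. [folklore] -/
theorem planar_step_cross {a b d1 d2 a' b' e1 e2 : ℤ} {θ s : ℝ}
    (hd : (d1 = 1 ∧ d2 = 0) ∨ (d1 = 0 ∧ d2 = 1) ∨ (d1 = 1 ∧ d2 = 1 ∧ ∃ k : ℤ, a + b = 2 * k + 1) ∨
      (d1 = 1 ∧ d2 = -1 ∧ ∃ k : ℤ, a + b = 2 * k + 1))
    (he : (e1 = 1 ∧ e2 = 0) ∨ (e1 = 0 ∧ e2 = 1) ∨ (e1 = 1 ∧ e2 = 1 ∧ ∃ k : ℤ, a' + b' = 2 * k + 1) ∨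
      (e1 = 1 ∧ e2 = -1 ∧ ∃ k : ℤ, a' + b' = 2 * k + 1))
    (hθ0 : 0 ≤ θ) (hθ1 : θ ≤ 1) (hs0 : 0 ≤ s) (hs1 : s ≤ 1)
    (hX : (a : ℝ) + θ * d1 = a' + s * e1) (hY : (b : ℝ) + θ * d2 = b' + s * e2) :
    (a = a' ∧ b = b') ∨ (a = a' + e1 ∧ b = b' + e2) ∨ (a + d1 = a' ∧ b + d2 = b') ∨
      (a + d1 = a' + e1 ∧ b + d2 = b' + e2) := by
  rcases hd with ⟨rfl, rfl⟩ | ⟨rfl, rfl⟩ | ⟨rfl, rfl, m, hm⟩ | ⟨rfl, rfl, m, hm⟩ <;>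
    rcases he with ⟨rfl, rfl⟩ | ⟨rfl, rfl⟩ | ⟨rfl, rfl, n, hn⟩ | ⟨rfl, rfl, n, hn⟩ <;>
    push_cast at hX hY
  · -- horizontal / horizontal
    have f := planar_unitI_int_sub (k := a' - a) (by push_cast; linarith) hθ0 hθ1 hs0 hs1
    have g : b = b' := by exact_mod_cast (show (b : ℝ) = b' by linarith)
    omega
  · -- horizontal / vertical
    have f := planar_unitI_int (k := a' - a) (by push_cast; linarith) hθ0 hθ1
    have g := planar_unitI_int (k := b - b') (by push_cast; linarith) hs0 hs1
    omega
  · -- horizontal / diagonal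
    have g := planar_unitI_int (k := b - b') (by push_cast; linarith) hs0 hs1
    have f := planar_unitI_int (k := a' - a + (b - b')) (by push_cast; linarith) hθ0 hθ1
    omega
  · -- horizontal / anti-diagonal
    have g := planar_unitI_int (k := b' - b) (by push_cast; linarith) hs0 hs1
    have f := planar_unitI_int (k := a' - a + (b' - b)) (by push_cast; linarith) hθ0 hθ1
    omega
  · -- vertical / horizontal
    have g := planar_unitI_int (k := a - a') (by push_cast; linarith) hs0 hs1
    have f := planar_unitI_int (k := b' - b) (by push_cast; linarith) hθ0 hθ1
    omega
  · -- vertical / vertical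
    have f := planar_unitI_int_sub (k := b' - b) (by push_cast; linarith) hθ0 hθ1 hs0 hs1
    have g : a = a' := by exact_mod_cast (show (a : ℝ) = a' by linarith)
    omega
  · -- vertical / diagonal
    have g := planar_unitI_int (k := a - a') (by push_cast; linarith) hs0 hs1
    have f := planar_unitI_int (k := b' - b + (a - a')) (by push_cast; linarith) hθ0 hθ1
    omega
  · -- vertical / anti-diagonal
    have g := planar_unitI_int (k := a - a') (by push_cast; linarith) hs0 hs1
    have f := planar_unitI_int (k := b' - b - (a - a')) (by push_cast; linarith) hθ0 hθ1
    omega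
  · -- diagonal / horizontal
    have f := planar_unitI_int (k := b' - b) (by push_cast; linarith) hθ0 hθ1
    have g := planar_unitI_int (k := a - a' + (b' - b)) (by push_cast; linarith) hs0 hs1
    omega
  · -- diagonal / vertical
    have f := planar_unitI_int (k := a' - a) (by push_cast; linarith) hθ0 hθ1
    have g := planar_unitI_int (k := b - b' + (a' - a)) (by push_cast; linarith) hs0 hs1
    omega
  · -- diagonal / diagonal
    have f := planar_unitI_int_sub (k := a' - a) (by push_cast; linarith) hθ0 hθ1 hs0 hs1
    have g : a - b = a' - b' := by exact_mod_cast (show (a : ℝ) - b = a' - b' by linarith)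
    omega
  · -- diagonal / anti-diagonal (parity)
    have hmR : (a : ℝ) + b = 2 * m + 1 := by exact_mod_cast hm
    have hnR : (a' : ℝ) + b' = 2 * n + 1 := by exact_mod_cast hn
    have f := planar_unitI_int (k := n - m) (by push_cast; linarith) hθ0 hθ1
    have g := planar_unitI_int (k := a - a' + (n - m)) (by push_cast; linarith) hs0 hs1
    omega
  · -- anti-diagonal / horizontal
    have f := planar_unitI_int (k := b - b') (by push_cast; linarith) hθ0 hθ1
    have g := planar_unitI_int (k := a - a' + (b - b')) (by push_cast; linarith) hs0 hs1
    omega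
  · -- anti-diagonal / vertical
    have f := planar_unitI_int (k := a' - a) (by push_cast; linarith) hθ0 hθ1
    have g := planar_unitI_int (k := b - b' - (a' - a)) (by push_cast; linarith) hs0 hs1
    omega
  · -- anti-diagonal / diagonal (parity)
    have hmR : (a : ℝ) + b = 2 * m + 1 := by exact_mod_cast hm
    have hnR : (a' : ℝ) + b' = 2 * n + 1 := by exact_mod_cast hn
    have g := planar_unitI_int (k := m - n) (by push_cast; linarith) hs0 hs1
    have f := planar_unitI_int (k := a' - a + (m - n)) (by push_cast; linarith) hθ0 hθ1
    omega
  · -- anti-diagonal / anti-diagonal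
    have f := planar_unitI_int_sub (k := a' - a) (by push_cast; linarith) hθ0 hθ1 hs0 hs1
    have g : a + b = a' + b' := by exact_mod_cast (show (a : ℝ) + b = a' + b' by linarith)
    omega

/-! ### The edges of `G_s` in integer coordinates -/

/-- One orientation of the generating relation of `G_s`, in integer coordinates: the edge is a step
`p ↦ p + d` of one of the four classes, from `u` or from `v`. [cite: Beffara2008Universal, §5.1] -/
theorem planar_gs_edge_aux {u v : MixedSite}
    (h : ∃ x : ℤ × ℤ, u = Sum.inl x ∧ (v = Sum.inl (x.1 + 1, x.2) ∨ v = Sum.inl (x.1, x.2 + 1) ∨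
      ∃ f : ℤ × ℤ, v = Sum.inr f ∧ (x.1 = f.1 ∨ x.1 = f.1 + 1) ∧ (x.2 = f.2 ∨ x.2 = f.2 + 1))) :
    ∃ a b d1 d2 : ℤ,
      ((d1 = 1 ∧ d2 = 0) ∨ (d1 = 0 ∧ d2 = 1) ∨ (d1 = 1 ∧ d2 = 1 ∧ ∃ k : ℤ, a + b = 2 * k + 1) ∨
        (d1 = 1 ∧ d2 = -1 ∧ ∃ k : ℤ, a + b = 2 * k + 1)) ∧
      ((Real.sqrt 2 * (zS u).re = a ∧ Real.sqrt 2 * (zS u).im = b ∧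
          Real.sqrt 2 * (zS v).re = ↑(a + d1) ∧ Real.sqrt 2 * (zS v).im = ↑(b + d2)) ∨
        (Real.sqrt 2 * (zS v).re = a ∧ Real.sqrt 2 * (zS v).im = b ∧
          Real.sqrt 2 * (zS u).re = ↑(a + d1) ∧ Real.sqrt 2 * (zS u).im = ↑(b + d2))) := by
  obtain ⟨⟨x1, x2⟩, rfl, h⟩ := h
  rcases h with rfl | rfl | ⟨⟨f1, f2⟩, rfl, h1, h2⟩
  · refine ⟨x1 + x2, x2 - x1 + 1, 1, -1, Or.inr (Or.inr (Or.inr ⟨rfl, rfl, x2, by ring⟩)),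
      Or.inl ⟨?_, ?_, ?_, ?_⟩⟩ <;>
    simp only [planar_zS_inl_re, planar_zS_inl_im] <;> exact Int.cast_inj.mpr (by omega)
  · refine ⟨x1 + x2, x2 - x1 + 1, 1, 1, Or.inr (Or.inr (Or.inl ⟨rfl, rfl, x2, by ring⟩)),
      Or.inl ⟨?_, ?_, ?_, ?_⟩⟩ <;>
    simp only [planar_zS_inl_re, planar_zS_inl_im] <;> exact Int.cast_inj.mpr (by omega)
  · simp only at h1 h2
    rcases h1 with h1 | h1 <;> rcases h2 with h2 | h2
    · refine ⟨x1 + x2, x2 - x1 + 1, 1, 0, Or.inl ⟨rfl, rfl⟩, Or.inl ⟨?_, ?_, ?_, ?_⟩⟩ <;>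
        simp only [planar_zS_inl_re, planar_zS_inl_im, planar_zS_inr_re, planar_zS_inr_im] <;>
        exact Int.cast_inj.mpr (by omega)
    · refine ⟨f1 + f2 + 1, f2 - f1 + 1, 0, 1, Or.inr (Or.inl ⟨rfl, rfl⟩), Or.inr ⟨?_, ?_, ?_, ?_⟩⟩ <;>
        simp only [planar_zS_inl_re, planar_zS_inl_im, planar_zS_inr_re, planar_zS_inr_im] <;>
        exact Int.cast_inj.mpr (by omega)
    · refine ⟨f1 + f2 + 1, f2 - f1, 0, 1, Or.inr (Or.inl ⟨rfl, rfl⟩), Or.inl ⟨?_, ?_, ?_, ?_⟩⟩ <;>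
        simp only [planar_zS_inl_re, planar_zS_inl_im, planar_zS_inr_re, planar_zS_inr_im] <;>
        exact Int.cast_inj.mpr (by omega)
    · refine ⟨f1 + f2 + 1, f2 - f1 + 1, 1, 0, Or.inl ⟨rfl, rfl⟩, Or.inr ⟨?_, ?_, ?_, ?_⟩⟩ <;>
        simp only [planar_zS_inl_re, planar_zS_inl_im, planar_zS_inr_re, planar_zS_inr_im] <;>
        exact Int.cast_inj.mpr (by omega)

/-- **Every edge of `G_s` is a step of one of the four classes** (diagonal steps only from odd points),
after orienting it suitably. [cite: Beffara2008Universal, §5.1] -/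
theorem planar_gs_edge {u v : MixedSite} (h : gsGraph.Adj u v) :
    ∃ a b d1 d2 : ℤ,
      ((d1 = 1 ∧ d2 = 0) ∨ (d1 = 0 ∧ d2 = 1) ∨ (d1 = 1 ∧ d2 = 1 ∧ ∃ k : ℤ, a + b = 2 * k + 1) ∨
        (d1 = 1 ∧ d2 = -1 ∧ ∃ k : ℤ, a + b = 2 * k + 1)) ∧
      ((Real.sqrt 2 * (zS u).re = a ∧ Real.sqrt 2 * (zS u).im = b ∧
          Real.sqrt 2 * (zS v).re = ↑(a + d1) ∧ Real.sqrt 2 * (zS v).im = ↑(b + d2)) ∨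
        (Real.sqrt 2 * (zS v).re = a ∧ Real.sqrt 2 * (zS v).im = b ∧
          Real.sqrt 2 * (zS u).re = ↑(a + d1) ∧ Real.sqrt 2 * (zS u).im = ↑(b + d2))) := by
  rw [gsGraph_eq, centredSquareGraph_adj_iff] at h
  obtain ⟨-, h | h⟩ := h
  · exact planar_gs_edge_aux h
  · obtain ⟨a, b, d1, d2, hc, he⟩ := planar_gs_edge_aux h
    exact ⟨a, b, d1, d2, hc, he.symm⟩

/-! ### Assembly -/

/-- **No vertex on a non-incident edge** (oriented form): a vertex drawn on the closed segment of a
step edge `u → v` is `u` or `v`. [folklore] -/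
theorem planar_gs_vertex_aux {u v w : MixedSite} {a b d1 d2 : ℤ}
    (hd : (d1 = 1 ∧ d2 = 0) ∨ (d1 = 0 ∧ d2 = 1) ∨ (d1 = 1 ∧ d2 = 1 ∧ ∃ k : ℤ, a + b = 2 * k + 1) ∨
      (d1 = 1 ∧ d2 = -1 ∧ ∃ k : ℤ, a + b = 2 * k + 1))
    (he : Real.sqrt 2 * (zS u).re = a ∧ Real.sqrt 2 * (zS u).im = b ∧
      Real.sqrt 2 * (zS v).re = ↑(a + d1) ∧ Real.sqrt 2 * (zS v).im = ↑(b + d2))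
    (hw : zS w ∈ segment ℝ (zS u) (zS v)) : w = u ∨ w = v := by
  obtain ⟨hua, hub, hva, hvb⟩ := he
  obtain ⟨θ, hθ0, hθ1, hre, him⟩ := planar_seg_param (Real.sqrt 2) hw
  obtain ⟨m, n, hm, hn⟩ : ∃ m n : ℤ, Real.sqrt 2 * (zS w).re = m ∧ Real.sqrt 2 * (zS w).im = n := by
    rcases w with ⟨x1, x2⟩ | ⟨f1, f2⟩
    · exact ⟨_, _, planar_zS_inl_re x1 x2, planar_zS_inl_im x1 x2⟩
    · exact ⟨_, _, planar_zS_inr_re f1 f2, planar_zS_inr_im f1 f2⟩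
  rw [hm, hua, hva] at hre
  rw [hn, hub, hvb] at him
  push_cast at hre him
  have hX : (a : ℝ) + θ * d1 = m := by linarith
  have hY : (b : ℝ) + θ * d2 = n := by linarith
  rcases planar_step_vertex hd hθ0 hθ1 hX hY with ⟨h1, h2⟩ | ⟨h1, h2⟩
  · exact Or.inl (planar_zS_eq_of_coord (by rw [hm, hua, h1]) (by rw [hn, hub, h2]))
  · exact Or.inr (planar_zS_eq_of_coord (by rw [hm, hva, h1]) (by rw [hn, hvb, h2]))

/-- **Crossing edges share a vertex** (oriented form): if the closed segments of two step edges
`u → v`, `u' → v'` meet, then `{u, v}` meets `{u', v'}`. [folklore] -/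
theorem planar_gs_cross_aux {u v u' v' : MixedSite} {z : ℂ} {a b d1 d2 a' b' e1 e2 : ℤ}
    (hd : (d1 = 1 ∧ d2 = 0) ∨ (d1 = 0 ∧ d2 = 1) ∨ (d1 = 1 ∧ d2 = 1 ∧ ∃ k : ℤ, a + b = 2 * k + 1) ∨
      (d1 = 1 ∧ d2 = -1 ∧ ∃ k : ℤ, a + b = 2 * k + 1))
    (hd' : (e1 = 1 ∧ e2 = 0) ∨ (e1 = 0 ∧ e2 = 1) ∨ (e1 = 1 ∧ e2 = 1 ∧ ∃ k : ℤ, a' + b' = 2 * k + 1) ∨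
      (e1 = 1 ∧ e2 = -1 ∧ ∃ k : ℤ, a' + b' = 2 * k + 1))
    (he : Real.sqrt 2 * (zS u).re = a ∧ Real.sqrt 2 * (zS u).im = b ∧
      Real.sqrt 2 * (zS v).re = ↑(a + d1) ∧ Real.sqrt 2 * (zS v).im = ↑(b + d2))
    (he' : Real.sqrt 2 * (zS u').re = a' ∧ Real.sqrt 2 * (zS u').im = b' ∧
      Real.sqrt 2 * (zS v').re = ↑(a' + e1) ∧ Real.sqrt 2 * (zS v').im = ↑(b' + e2))
    (hz : z ∈ segment ℝ (zS u) (zS v)) (hz' : z ∈ segment ℝ (zS u') (zS v')) :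
    u = u' ∨ u = v' ∨ v = u' ∨ v = v' := by
  obtain ⟨hua, hub, hva, hvb⟩ := he
  obtain ⟨hua', hub', hva', hvb'⟩ := he'
  obtain ⟨θ, hθ0, hθ1, hre, him⟩ := planar_seg_param (Real.sqrt 2) hz
  obtain ⟨s, hs0, hs1, hre', him'⟩ := planar_seg_param (Real.sqrt 2) hz'
  rw [hua, hva] at hre
  rw [hub, hvb] at him
  rw [hua', hva'] at hre'
  rw [hub', hvb'] at him'
  push_cast at hre him hre' him'
  have hX : (a : ℝ) + θ * d1 = a' + s * e1 := by linarith
  have hY : (b : ℝ) + θ * d2 = b' + s * e2 := by linarith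
  rcases planar_step_cross hd hd' hθ0 hθ1 hs0 hs1 hX hY with ⟨h1, h2⟩ | ⟨h1, h2⟩ | ⟨h1, h2⟩ | ⟨h1, h2⟩
  · exact Or.inl (planar_zS_eq_of_coord (by rw [hua, hua', h1]) (by rw [hub, hub', h2]))
  · exact Or.inr (Or.inl (planar_zS_eq_of_coord (by rw [hua, hva', h1]) (by rw [hub, hvb', h2])))
  · exact Or.inr (Or.inr (Or.inl
      (planar_zS_eq_of_coord (by rw [hva, hua', h1]) (by rw [hvb, hub', h2]))))
  · exact Or.inr (Or.inr (Or.inr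
      (planar_zS_eq_of_coord (by rw [hva, hva', h1]) (by rw [hvb, hvb', h2]))))

/-- **STUB `stub_gsPlanar` — the straight-line drawing `zS` of `G_s` is planar**: `zS` is injective,
no vertex lies on a non-incident closed edge segment, and vertex-disjoint edges have disjoint closed
segments. [cite: Beffara2008Universal, §5.1] -/
theorem stub_gsPlanar : Summit.CriticalPhenomena.CardyFormulaZ2.Cruxes.CoveringLeg.FiveArmNull.Sig.stub_gsPlanar := by
  unfold Sig.stub_gsPlanar
  refine ⟨planar_zS_injective, fun u v w huv hwu hwv hw => ?_,
    fun u v u' v' h h' h1 h2 h3 h4 => ?_⟩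
  · obtain ⟨a, b, d1, d2, hd, he | he⟩ := planar_gs_edge huv
    · rcases planar_gs_vertex_aux hd he hw with rfl | rfl <;> contradiction
    · rw [segment_symm] at hw
      rcases planar_gs_vertex_aux hd he hw with rfl | rfl <;> contradiction
  · rw [Set.disjoint_left]
    intro z hz hz'
    obtain ⟨a, b, d1, d2, hd, he⟩ := planar_gs_edge h
    obtain ⟨a', b', e1, e2, hd', he'⟩ := planar_gs_edge h'
    rcases he with he | he <;> rcases he' with he' | he'
    · rcases planar_gs_cross_aux hd hd' he he' hz hz' with rfl | rfl | rfl | rfl <;> contradiction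
    · rw [segment_symm] at hz'
      rcases planar_gs_cross_aux hd hd' he he' hz hz' with rfl | rfl | rfl | rfl <;> contradiction
    · rw [segment_symm] at hz
      rcases planar_gs_cross_aux hd hd' he he' hz hz' with rfl | rfl | rfl | rfl <;> contradiction
    · rw [segment_symm] at hz hz'
      rcases planar_gs_cross_aux hd hd' he he' hz hz' with rfl | rfl | rfl | rfl <;> contradiction

end Summit.CriticalPhenomena.CardyFormulaZ2.Cruxes.CoveringLeg.FiveArmNull

end
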